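import Summits.ValiantsHypothesis.ValiantsHypothesis.Theorems.KPlusLogSqLawStaticPathTransposition
import Summits.ValiantsHypothesis.ValiantsHypothesis.Theorems.KPlusLogSqLawStaticPathMixedEvents

/-!
# Route «KPlusLogSqLaw» — parametric max-weight independent set on a path: THEOREM T in the sweep's currency — at most `2n` MIXED event crossings

HONEST FRAMING.  Helper toward the crux `WeakLifting` (item `stmt-ValiantsHypothesis-19561`, route `KPlusLogSqLaw`, cell `pub-symmetroid`,
seat val-sym-lift-p4 g20, 2026-08-29) on the line of its witness-plan stub `stub_tridiagonalSectorB` (tropical twin of the STATIC tridiagonal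
sector = parametric maximum-weight independent set on a path).  The BRIDGE between the kernel's fold-language event crossings
(`…StaticPathTropicalCount.sweep_count_eq`: the changes of the optimal independent set along a generic sweep are in bijection with the pairs
`p < q` crossing with `lab (q-1) = p` and `q` a right record of the reversed block) and the ORDER-TYPE criterion of EVENT-CRITERION Theorem 1
(val-sym-lift-p4 g16) used by THEOREM T (`…StaticPathMixedEvents.mixedEvents_card_le`, val-sym-lift-p4 g14/g20):
(1) `fold_lt_iff_nearestBad_even` — THE LADDER: with no line through the level `y`, the alternating fold of lines `0..k` lies below `y` iff the
largest index `≤ k` on its wrong side of `y` exists and is even; (2) `fold_eq_L_iff_even_run` — a line is a touch point of the fold (a left record)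
iff the maximal run of earlier lines on their correct side of it has EVEN length (the (L) clause); (3) `gap_rev_eq` — the signed gaps of the
reversed block's prefix-sum lines are the block's read from the right (`L_rev_sub`), so the right-record clause is the (R) clause
(`eventCrossing_iff_criterion` = EVENT-CRITERION Theorem 1 in the kernel: the fold-language event test IS the order-type
criterion, so the tropical count is a function of the 2-coloured order type); (4) `mixed_eventCrossings_card_le` — hence, for prefix-sum lines with pairwise distinct slopes and no third line
through a crossing, AT MOST `2n` of the event crossings in any window have indices of opposite parity (these are the changes of the optimum that
change its SIZE: pair creations / annihilations of vacancies).  Statements about a path DP; nothing here asserts anything about `WeakLifting`,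
`TropicalB`, `KPlusLogSqLaw`, the stub in its window, `MatrixDescartes` (stmt-ValiantsHypothesis-18050) or `VP ≠ VNP`; the same-parity event
crossings («hops») and the ORDER QUESTION stay open.
-/

set_option linter.dupNamespace false
set_option autoImplicit false

namespace Summit.ValiantsHypothesis.ValiantsHypothesis.Theorems.KPlusLogSqLaw

open Finset Classical

namespace StaticPathFold

noncomputable section

section Ladder

variable (a b : ℕ → ℝ)

/-- **THE LADDER** (EVENT-CRITERION Theorem 1's unfolding of the fold; STATIC-PATH-NLOGN (1d)): if no line `t ≤ k` passes through the level `y`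
at `θ`, then the alternating fold of the lines `0..k` lies BELOW `y` iff the largest index `t ≤ k` whose line is on its wrong side of `y` (even lines
belong above, odd lines below) exists and is EVEN. [folklore] -/
theorem fold_lt_iff_nearestBad_even (k : ℕ) (θ y : ℝ) (hne : ∀ t, t ≤ k → L a b t θ ≠ y) :
    fold a b k θ < y ↔ ∃ t, t ≤ k ∧ Even t ∧ gap t y (L a b t θ) < 0 ∧ ∀ s, t < s → s ≤ k → 0 < gap s y (L a b s θ) := by
  induction k with
  | zero =>
    rw [fold_zero]
    constructor
    · intro h
      refine ⟨0, le_rfl, Even.zero, ?_, fun s h1 h2 => by omega⟩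
      unfold gap; rw [if_pos Even.zero]; linarith
    · rintro ⟨t, ht, -, hbad, -⟩
      obtain rfl : t = 0 := Nat.le_zero.mp ht
      unfold gap at hbad; rw [if_pos Even.zero] at hbad; linarith
  | succ k ih =>
    have ih' := ih (fun t ht => hne t (by omega))
    have hk1 : L a b (k + 1) θ ≠ y := hne (k + 1) le_rfl
    rw [fold_succ]
    by_cases hke : Even (k + 1)
    · rw [if_pos hke, min_lt_iff]
      constructor
      · rintro (h | h)
        · refine ⟨k + 1, le_rfl, hke, ?_, fun s h1 h2 => by omega⟩
          unfold gap; rw [if_pos hke]; linarith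
        · obtain ⟨t, ht, hte, hbad, hgood⟩ := ih'.mp h
          by_cases hk : L a b (k + 1) θ < y
          · refine ⟨k + 1, le_rfl, hke, ?_, fun s h1 h2 => by omega⟩
            unfold gap; rw [if_pos hke]; linarith
          · refine ⟨t, by omega, hte, hbad, fun s h1 h2 => ?_⟩
            rcases Nat.lt_or_ge s (k + 1) with hs | hs
            · exact hgood s h1 (by omega)
            · obtain rfl : s = k + 1 := by omega
              unfold gap; rw [if_pos hke]
              exact sub_pos.mpr (lt_of_le_of_ne (not_lt.mp hk) (Ne.symm hk1))
      · rintro ⟨t, ht, hte, hbad, hgood⟩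
        rcases Nat.lt_or_ge t (k + 1) with htk | htk
        · right
          exact ih'.mpr ⟨t, by omega, hte, hbad, fun s h1 h2 => hgood s h1 (by omega)⟩
        · obtain rfl : t = k + 1 := by omega
          left
          unfold gap at hbad; rw [if_pos hke] at hbad; linarith
    · rw [if_neg hke, max_lt_iff]
      have hko : ¬ Even (k + 1) := hke
      constructor
      · rintro ⟨h1, h2⟩
        obtain ⟨t, ht, hte, hbad, hgood⟩ := ih'.mp h2
        refine ⟨t, by omega, hte, hbad, fun s hs1 hs2 => ?_⟩
        rcases Nat.lt_or_ge s (k + 1) with hs | hs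
        · exact hgood s hs1 (by omega)
        · obtain rfl : s = k + 1 := by omega
          unfold gap; rw [if_neg hko]; linarith
      · rintro ⟨t, ht, hte, hbad, hgood⟩
        have htk : t < k + 1 := by
          rcases Nat.lt_or_ge t (k + 1) with h | h
          · exact h
          · obtain rfl : t = k + 1 := by omega
            exact absurd hte hko
        have hg := hgood (k + 1) htk le_rfl
        unfold gap at hg; rw [if_neg hko] at hg
        exact ⟨by linarith, ih'.mpr ⟨t, by omega, hte, hbad, fun s h1 h2 => hgood s h1 (by omega)⟩⟩

/-- **TOUCHING = EVEN RUN** (EVENT-CRITERION Theorem 1, the (L) half): if no earlier line passes through `L p θ`, the alternating fold touches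
line `p` at `θ` (`fold p θ = L p θ`, i.e. `p` is a left record) iff the maximal run of lines `p-1, p-2, …` strictly on their correct side of
`L p θ` has even length. [folklore] -/
theorem fold_eq_L_iff_even_run (p : ℕ) (θ : ℝ) (hne : ∀ t, t < p → L a b t θ ≠ L a b p θ) :
    fold a b p θ = L a b p θ ↔
      ∃ r, Even r ∧ r ≤ p ∧ (∀ t, p - r ≤ t → t < p → 0 < gap t (L a b p θ) (L a b t θ)) ∧
        (r = p ∨ ¬ 0 < gap (p - r - 1) (L a b p θ) (L a b (p - r - 1) θ)) := by
  rcases Nat.eq_zero_or_pos p with hp | hp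
  · subst hp
    rw [fold_zero]
    simp only [true_iff]
    exact ⟨0, Even.zero, le_rfl, fun t h1 h2 => by omega, Or.inl rfl⟩
  obtain ⟨k, rfl⟩ : ∃ k, p = k + 1 := ⟨p - 1, by omega⟩
  set y := L a b (k + 1) θ with hy
  have hne' : ∀ t, t ≤ k → L a b t θ ≠ y := fun t ht => hne t (by omega)
  have hlad := fold_lt_iff_nearestBad_even a b k θ y hne'
  -- no ties: `good` and `bad` are complementary on `0..k`
  have hgb : ∀ t, t ≤ k → (¬ 0 < gap t y (L a b t θ) ↔ gap t y (L a b t θ) < 0) := by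
    intro t ht
    have h : gap t y (L a b t θ) ≠ 0 := by
      unfold gap; split_ifs
      · exact sub_ne_zero.mpr (hne' t ht)
      · exact sub_ne_zero.mpr (Ne.symm (hne' t ht))
    constructor
    · intro h1; exact lt_of_le_of_ne (not_lt.mp h1) h
    · intro h1 h2; linarith
  -- the fold at `k` is one of the lines `0..k`, hence not at `y`
  have hfk : fold a b k θ ≠ y := by rw [fold_eq_lab]; exact hne' _ (lab_le a b k θ)
  -- the touch test against the ladder
  have htouch : fold a b (k + 1) θ = y ↔ (Even (k + 1) ↔ ¬ fold a b k θ < y) := by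
    rw [fold_succ]
    by_cases hke : Even (k + 1)
    · rw [if_pos hke, min_eq_left_iff]
      simp only [hke, true_iff, not_lt]
      rw [hy]
    · rw [if_neg hke, max_eq_left_iff]
      simp only [hke, false_iff, not_not]
      exact ⟨fun h => lt_of_le_of_ne h hfk, le_of_lt⟩
  rw [htouch, hlad]
  -- parity bookkeeping
  have hpar : ∀ t, t ≤ k → (Even (k - t) ↔ (Even (k + 1) ↔ ¬ Even t)) := by
    intro t ht
    rw [Nat.even_sub ht, Nat.even_add_one]
    tauto
  by_cases hall : ∀ t, t ≤ k → 0 < gap t y (L a b t θ)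
  · -- (A) no bad index below: touching iff `k + 1` is even; the run is everything
    have hnb : ¬ ∃ t, t ≤ k ∧ Even t ∧ gap t y (L a b t θ) < 0 ∧ ∀ s, t < s → s ≤ k → 0 < gap s y (L a b s θ) := by
      rintro ⟨t, ht, -, hbad, -⟩; have := hall t ht; linarith
    constructor
    · intro h
      exact ⟨k + 1, h.mpr hnb, le_rfl, fun t h1 h2 => hall t (by omega), Or.inl rfl⟩
    · rintro ⟨r, hre, hrp, -, hend⟩
      rcases hend with hr | hr
      · rw [hr] at hre; exact ⟨fun _ => hnb, fun _ => hre⟩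
      · exact absurd (hall _ (by omega)) hr
  · -- (B) the largest bad index `t₁ ≤ k`
    push Not at hall
    obtain ⟨t₀, ht₀, hbad₀⟩ := hall
    have hbad₀' : ¬ 0 < gap t₀ y (L a b t₀ θ) := not_lt.mpr hbad₀
    set t₁ := Nat.findGreatest (fun t => ¬ 0 < gap t y (L a b t θ)) k with ht₁
    have hspec : ¬ 0 < gap t₁ y (L a b t₁ θ) := Nat.findGreatest_spec (P := fun t => ¬ 0 < gap t y (L a b t θ)) ht₀ hbad₀'
    have ht₁k : t₁ ≤ k := Nat.findGreatest_le k
    have hafter : ∀ s, t₁ < s → s ≤ k → 0 < gap s y (L a b s θ) := fun s h1 h2 =>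
      not_not.mp (Nat.findGreatest_is_greatest h1 h2)
    have hspec' : gap t₁ y (L a b t₁ θ) < 0 := (hgb t₁ ht₁k).mp hspec
    -- the ladder condition says `t₁` is even
    have h1 : (∃ t, t ≤ k ∧ Even t ∧ gap t y (L a b t θ) < 0 ∧ ∀ s, t < s → s ≤ k → 0 < gap s y (L a b s θ)) ↔ Even t₁ := by
      constructor
      · rintro ⟨t, ht, hte, hbad, hgood⟩
        have h2 : t = t₁ := by
          rcases lt_trichotomy t t₁ with h | h | h
          · have := hgood t₁ h ht₁k; linarith
          · exact h
          · have := hafter t h ht; linarith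
        rwa [← h2]
      · intro he; exact ⟨t₁, ht₁k, he, hspec', hafter⟩
    -- the run condition says `k - t₁` is even
    have h2 : (∃ r, Even r ∧ r ≤ k + 1 ∧ (∀ t, k + 1 - r ≤ t → t < k + 1 → 0 < gap t y (L a b t θ)) ∧
        (r = k + 1 ∨ ¬ 0 < gap (k + 1 - r - 1) y (L a b (k + 1 - r - 1) θ))) ↔ Even (k - t₁) := by
      constructor
      · rintro ⟨r, hre, hrp, hrun, hend⟩
        have hr1 : r ≤ k - t₁ := by
          by_contra hlt
          exact hspec (hrun t₁ (by omega) (by omega))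
        rcases hend with hr | hr
        · omega
        · have hr2 : k - r = t₁ := by
            by_contra hne2
            exact hr (by rw [show k + 1 - r - 1 = k - r by omega]; exact hafter (k - r) (by omega) (by omega))
          rw [← hr2, show k - (k - r) = r by omega]; exact hre
      · intro he
        refine ⟨k - t₁, he, by omega, fun t h3 h4 => hafter t (by omega) (by omega), Or.inr ?_⟩
        rw [show k + 1 - (k - t₁) - 1 = t₁ by omega]; exact hspec
    rw [h1, h2, hpar t₁ ht₁k]

end Ladder

/-! ## 2. The reversed block: its fold conditions read as right-end conditions of the block -/

section RevBridge

variable (w₁ w₀ : ℕ → ℝ)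

/-- the signed gaps of the REVERSED block's prefix-sum lines are the signed gaps of the block's, read from the right end:
`gap s (L' (n-q)) (L' s) = gap (n-s) (L q) (L (n-s))` (from `L_rev_sub`). [folklore] -/
theorem gap_rev_eq {i n s q : ℕ} (hs : s ≤ n) (hq : q ≤ n) (τ : ℝ) :
    gap s (L (altA (shift 0 (rev i n w₁))) (altB (shift 0 (rev i n w₀))) (n - q) τ)
        (L (altA (shift 0 (rev i n w₁))) (altB (shift 0 (rev i n w₀))) s τ) =
      gap (n - s) (L (altA (shift i w₁)) (altB (shift i w₀)) q τ) (L (altA (shift i w₁)) (altB (shift i w₀)) (n - s) τ) := by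
  have h := L_rev_sub w₁ w₀ (i := i) (p := n - q) (q := s) (by omega) hs τ
  rw [show n - (n - q) = q by omega] at h
  have hns : Even (n - s) ↔ (Even n ↔ Even s) := Nat.even_sub hs
  unfold gap
  rcases Nat.even_or_odd n with hn | hn
  · have h1 : ((-1 : ℝ)) ^ (n + 1) = -1 := Odd.neg_one_pow (hn.add_one)
    rw [h1] at h
    by_cases hse : Even s
    · rw [if_pos hse, if_pos (hns.mpr ⟨fun _ => hse, fun _ => hn⟩)]; linarith
    · rw [if_neg hse, if_neg (fun h2 => hse ((hns.mp h2).mp hn))]; linarith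
  · have h1 : ((-1 : ℝ)) ^ (n + 1) = 1 := Even.neg_one_pow (hn.add_one)
    rw [h1, one_mul] at h
    have hn' : ¬ Even n := Nat.not_even_iff_odd.mpr hn
    by_cases hse : Even s
    · rw [if_pos hse, if_neg (fun h2 => hn' ((hns.mp h2).mpr hse))]; linarith
    · rw [if_neg hse, if_pos (hns.mpr ⟨fun h2 => absurd h2 hn', fun h2 => absurd h2 hse⟩)]; linarith

/-- **EVENT-CRITERION THEOREM 1 (kernel form): the fold-language event test IS the order-type criterion.**  For the prefix-sum lines `S_0, …, S_n` of the
block `i+1, …, i+n` and a pair `p < q ≤ n` with distinct slopes at whose crossing no other `S_t`, `t ≤ n`, passes through the vertex, `(p, q)` is an event crossing of `sweep_count_eq` (`lab (q-1) τ = p` and line `n - q` of the reversed block touches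
its fold at `τ`) IF AND ONLY IF (M), (L), (R) hold at the vertex — so the tropical count of the static path sector is a function of the
2-coloured order type of the dual points (val-sym-lift-p4 g16, `EVENT-CRITERION.md` Theorem 1, there derived on paper from `sweep_count_eq`). [folklore] -/
theorem eventCrossing_iff_criterion {i n p q : ℕ} (hpq : p < q) (hqn : q ≤ n)
    (hA : altA (shift i w₁) p ≠ altA (shift i w₁) q)
    (hgp : ∀ t, t ≤ n → t ≠ p → t ≠ q →
      L (altA (shift i w₁)) (altB (shift i w₀)) t
          ((altB (shift i w₀) q - altB (shift i w₀) p) / (altA (shift i w₁) p - altA (shift i w₁) q)) ≠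
        L (altA (shift i w₁)) (altB (shift i w₀)) p
          ((altB (shift i w₀) q - altB (shift i w₀) p) / (altA (shift i w₁) p - altA (shift i w₁) q))) :
    (lab (altA (shift i w₁)) (altB (shift i w₀)) (q - 1)
        ((altB (shift i w₀) q - altB (shift i w₀) p) / (altA (shift i w₁) p - altA (shift i w₁) q)) = p ∧
      fold (altA (shift 0 (rev i n w₁))) (altB (shift 0 (rev i n w₀))) (n - q)
          ((altB (shift i w₀) q - altB (shift i w₀) p) / (altA (shift i w₁) p - altA (shift i w₁) q)) =
        L (altA (shift 0 (rev i n w₁))) (altB (shift 0 (rev i n w₀))) (n - q)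
          ((altB (shift i w₀) q - altB (shift i w₀) p) / (altA (shift i w₁) p - altA (shift i w₁) q))) ↔
    ((∀ t, p < t → t < q → 0 < gap t
        (L (altA (shift i w₁)) (altB (shift i w₀)) p ((altB (shift i w₀) q - altB (shift i w₀) p) / (altA (shift i w₁) p - altA (shift i w₁) q)))
        (L (altA (shift i w₁)) (altB (shift i w₀)) t ((altB (shift i w₀) q - altB (shift i w₀) p) / (altA (shift i w₁) p - altA (shift i w₁) q)))) ∧
    (∃ r, Even r ∧ r ≤ p ∧ (∀ t, p - r ≤ t → t < p → 0 < gap t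
        (L (altA (shift i w₁)) (altB (shift i w₀)) p ((altB (shift i w₀) q - altB (shift i w₀) p) / (altA (shift i w₁) p - altA (shift i w₁) q)))
        (L (altA (shift i w₁)) (altB (shift i w₀)) t ((altB (shift i w₀) q - altB (shift i w₀) p) / (altA (shift i w₁) p - altA (shift i w₁) q)))) ∧
      (r = p ∨ ¬ 0 < gap (p - r - 1)
        (L (altA (shift i w₁)) (altB (shift i w₀)) p ((altB (shift i w₀) q - altB (shift i w₀) p) / (altA (shift i w₁) p - altA (shift i w₁) q)))
        (L (altA (shift i w₁)) (altB (shift i w₀)) (p - r - 1)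
          ((altB (shift i w₀) q - altB (shift i w₀) p) / (altA (shift i w₁) p - altA (shift i w₁) q))))) ∧
    (∃ r, Even r ∧ q + r ≤ n ∧ (∀ t, q < t → t ≤ q + r → 0 < gap t
        (L (altA (shift i w₁)) (altB (shift i w₀)) p ((altB (shift i w₀) q - altB (shift i w₀) p) / (altA (shift i w₁) p - altA (shift i w₁) q)))
        (L (altA (shift i w₁)) (altB (shift i w₀)) t ((altB (shift i w₀) q - altB (shift i w₀) p) / (altA (shift i w₁) p - altA (shift i w₁) q)))) ∧
      (q + r = n ∨ ¬ 0 < gap (q + r + 1)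
        (L (altA (shift i w₁)) (altB (shift i w₀)) p ((altB (shift i w₀) q - altB (shift i w₀) p) / (altA (shift i w₁) p - altA (shift i w₁) q)))
        (L (altA (shift i w₁)) (altB (shift i w₀)) (q + r + 1)
          ((altB (shift i w₀) q - altB (shift i w₀) p) / (altA (shift i w₁) p - altA (shift i w₁) q)))))) := by
  constructor
  · rintro ⟨hlab, hright⟩
    set A := altA (shift i w₁) with hAdef
    set B := altB (shift i w₀) with hBdef
    set A' := altA (shift 0 (rev i n w₁)) with hA'def
    set B' := altB (shift 0 (rev i n w₀)) with hB'def
    set τ := (B q - B p) / (A p - A q) with hτ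
    -- (M) and (L) from the left fold
    obtain ⟨htouch, hI⟩ := (lab_pred_eq_iff A B hpq τ).mp hlab
    have hM : ∀ t, p < t → t < q → 0 < gap t (L A B p τ) (L A B t τ) := fun t h1 h2 => hI t h1 (by omega)
    have hL := (fold_eq_L_iff_even_run A B p τ (fun t ht => hgp t (by omega) (by omega) (by omega))).mp htouch
    refine ⟨hM, hL, ?_⟩
    -- (R) from the right fold, through the reversed block
    have hcross : L A B q τ = L A B p τ := by rw [hτ]; exact L_eq_L_crossAbs A B hA
    have hne' : ∀ s, s < n - q → L A' B' s τ ≠ L A' B' (n - q) τ := by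
      intro s hs heq
      have h := gap_rev_eq w₁ w₀ (i := i) (n := n) (s := s) (q := q) (by omega) hqn τ
      have hz : gap s (L A' B' (n - q) τ) (L A' B' s τ) = 0 := by unfold gap; split_ifs <;> rw [heq] <;> ring
      rw [hz] at h
      have hgs := hgp (n - s) (by omega) (by omega) (by omega)
      rw [← hcross] at hgs
      apply hgs
      have h' := h.symm
      unfold gap at h'
      split_ifs at h' <;> linarith
    obtain ⟨r, hre, hrq, hrun, hend⟩ := (fold_eq_L_iff_even_run A' B' (n - q) τ hne').mp hright
    refine ⟨r, hre, by omega, fun t ht1 ht2 => ?_, ?_⟩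
    · have h := hrun (n - t) (by omega) (by omega)
      rw [gap_rev_eq w₁ w₀ (by omega) hqn, show n - (n - t) = t by omega, hcross] at h
      exact h
    · by_cases hr2 : r = n - q
      · exact Or.inl (by omega)
      rcases hend with hr | hr
      · exact absurd hr hr2
      · right
        rw [gap_rev_eq w₁ w₀ (by omega) hqn, show n - (n - q - r - 1) = q + r + 1 by omega, hcross] at hr
        exact hr
  · rintro ⟨hM, hL, hR⟩
    set A := altA (shift i w₁) with hAdef
    set B := altB (shift i w₀) with hBdef
    set A' := altA (shift 0 (rev i n w₁)) with hA'def
    set B' := altB (shift 0 (rev i n w₀)) with hB'def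
    set τ := (B q - B p) / (A p - A q) with hτ
    have hcross : L A B q τ = L A B p τ := by rw [hτ]; exact L_eq_L_crossAbs A B hA
    constructor
    · -- left fold: touch point by the even run, clean stretch by (M)
      rw [lab_pred_eq_iff A B hpq τ]
      exact ⟨(fold_eq_L_iff_even_run A B p τ (fun t ht => hgp t (by omega) (by omega) (by omega))).mpr hL,
        fun t h1 h2 => hM t h1 (by omega)⟩
    · -- right fold: the even run of (R), read through the reversed block
      have hne' : ∀ s, s < n - q → L A' B' s τ ≠ L A' B' (n - q) τ := by
        intro s hs heq
        have h := gap_rev_eq w₁ w₀ (i := i) (n := n) (s := s) (q := q) (by omega) hqn τ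
        have hz : gap s (L A' B' (n - q) τ) (L A' B' s τ) = 0 := by unfold gap; split_ifs <;> rw [heq] <;> ring
        rw [hz] at h
        have hgs := hgp (n - s) (by omega) (by omega) (by omega)
        rw [← hcross] at hgs
        apply hgs
        have h' := h.symm
        unfold gap at h'
        split_ifs at h' <;> linarith
      apply (fold_eq_L_iff_even_run A' B' (n - q) τ hne').mpr
      obtain ⟨r, hre, hrq, hrun, hend⟩ := hR
      refine ⟨r, hre, by omega, fun s hs1 hs2 => ?_, ?_⟩
      · rw [gap_rev_eq w₁ w₀ (by omega) hqn, hcross]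
        exact hrun (n - s) (by omega) (by omega)
      · by_cases hqr : q + r = n
        · exact Or.inl (by omega)
        rcases hend with hr | hr
        · exact absurd hr hqr
        · right
          rw [gap_rev_eq w₁ w₀ (by omega) hqn, show n - (n - q - r - 1) = q + r + 1 by omega, hcross]
          exact hr

end RevBridge

/-! ## 3. THEOREM T in the currency of `sweep_count_eq`: at most `2n` event crossings of mixed parity -/

section Count

variable (w₁ w₀ : ℕ → ℝ)

/-- **AT MOST `2n` MIXED EVENT CROSSINGS.**  For the block `i+1, …, i+n` with prefix-sum lines in general position (pairwise distinct slopes, and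
no third prefix-sum line through any crossing), the EVENT CROSSINGS of `sweep_count_eq` (pairs `p < q` crossing in the window with `p` the active
index of the left fold just below `q` and `q` a right record) whose indices have opposite parities — the changes of the optimal independent set
that change its SIZE — are at most `2n`, in every window `(θlo, θhi)`: by `eventCrossing_iff_criterion` they are mixed events of the labelled
arrangement `S_0, …, S_n` in the sense of `mixedEvents_card_le` (THEOREM T). [folklore] -/
theorem mixed_eventCrossings_card_le (i n : ℕ) (θlo θhi : ℝ)
    (hslope : ∀ p q, p ≤ n → q ≤ n → p ≠ q → altA (shift i w₁) p ≠ altA (shift i w₁) q)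
    (hgp : ∀ p q t, p ≤ n → q ≤ n → t ≤ n → p ≠ q → t ≠ p → t ≠ q →
      L (altA (shift i w₁)) (altB (shift i w₀)) t
          ((altB (shift i w₀) q - altB (shift i w₀) p) / (altA (shift i w₁) p - altA (shift i w₁) q)) ≠
        L (altA (shift i w₁)) (altB (shift i w₀)) p
          ((altB (shift i w₀) q - altB (shift i w₀) p) / (altA (shift i w₁) p - altA (shift i w₁) q))) :
    (((range (n + 1)) ×ˢ (range (n + 1))).filter (fun pq : ℕ × ℕ => pq.1 < pq.2 ∧
        altA (shift i w₁) pq.1 ≠ altA (shift i w₁) pq.2 ∧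
        θlo < (altB (shift i w₀) pq.2 - altB (shift i w₀) pq.1) / (altA (shift i w₁) pq.1 - altA (shift i w₁) pq.2) ∧
        (altB (shift i w₀) pq.2 - altB (shift i w₀) pq.1) / (altA (shift i w₁) pq.1 - altA (shift i w₁) pq.2) < θhi ∧
        lab (altA (shift i w₁)) (altB (shift i w₀)) (pq.2 - 1)
            ((altB (shift i w₀) pq.2 - altB (shift i w₀) pq.1) / (altA (shift i w₁) pq.1 - altA (shift i w₁) pq.2)) = pq.1 ∧
        fold (altA (shift 0 (rev i n w₁))) (altB (shift 0 (rev i n w₀))) (n - pq.2)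
            ((altB (shift i w₀) pq.2 - altB (shift i w₀) pq.1) / (altA (shift i w₁) pq.1 - altA (shift i w₁) pq.2)) =
          L (altA (shift 0 (rev i n w₁))) (altB (shift 0 (rev i n w₀))) (n - pq.2)
            ((altB (shift i w₀) pq.2 - altB (shift i w₀) pq.1) / (altA (shift i w₁) pq.1 - altA (shift i w₁) pq.2)) ∧
        Odd (pq.1 + pq.2))).card ≤ 2 * n := by
  have hT := mixedEvents_card_le (altA (shift i w₁)) (altB (shift i w₀)) n hslope hgp
  refine le_trans (card_le_card ?_) hT
  intro pq hpq
  simp only [mem_filter, mem_product, mem_range] at hpq ⊢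
  obtain ⟨hP, h1, h2, -, -, h5, h6, h7⟩ := hpq
  have hqn : pq.2 ≤ n := by omega
  have crit := (eventCrossing_iff_criterion w₁ w₀ h1 hqn h2
    (fun t ht htp htq => hgp pq.1 pq.2 t (by omega) hqn ht (ne_of_lt h1) htp htq)).mp ⟨h5, h6⟩
  exact ⟨hP, h1, hqn, h7, crit.1, crit.2.1, crit.2.2⟩

end Count

end

end StaticPathFold

end Summit.ValiantsHypothesis.ValiantsHypothesis.Theorems.KPlusLogSqLaw
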